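import Summits.ResolutionOfSingularities.ResolutionOfSingularities.Theorems.MarkedTransferCampaignW46MohWindowShadeFormalNRChart
import Summits.ResolutionOfSingularities.ResolutionOfSingularities.Theorems.WildConesCampaignW46FormalChartAssembly
import Summits.ResolutionOfSingularities.ResolutionOfSingularities.Theorems.WildConesCampaignW46AtomChartOrder
import Literature.AlgebraicGeometry.Resolution.AdicNoetherian
import HarnessLib

/-!
# [OURS · L1 W4.6 rung (iii-2), NON-RATIONAL POINTS, brick 6] Ring-level preparations for the non-rational scheme step: the residue field
# read through Cohen coordinates; the fibre quotient `z/uᵢ` lies in `𝔪` at a singular point of the transform; the `z`-chart origin is not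
# singular; the origin of a chart as non-rational chart data with `π̃ = X`

Cell `res-hironaka`, LADDER-RESOLUTION rung L (D-0089), slot W4.6 rung (iii); seat res-L1-s46-pv-6 (gen 7). Host route MarkedTransfer,
`--supports stmt-ResolutionOfSingularities-16155 --as helper`; kind proof (no definition). Pure local algebra around a series anchor
`E₀(f₀) = w · (z^p + F(u))` with `ord F > p` (the window regime has `ord F = d > p`): then `f₀ ≡ u · c_z^p (mod 𝔪_R^{p+1})` for a unit `u`
(`exists_unit_sub_mul_pow_mem`), so at a point of the blow-up in the chart `cᵢ`, `i ≠ z`, at which the controlled transform `f′` is not a unit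
the quotient `e_z = c_z/cᵢ` lies in `𝔪` (`e_mem_maximalIdeal_of_transform` — the point lies on the line `z = 0` of the exceptional plane),
and the origin of the `z`-chart is never such a point (`false_of_zChart_nr`; non-rational twin of gen 6's `not_mem_maximalIdeal_transform_of_zChart_series`,
without `hrat`). Also: the residue field of `R` is identified with the coefficient field of the Cohen coordinates
(`exists_residueField_ringEquiv`), and chart data at the ORIGIN of a chart are non-rational chart data with `π̃ = X`
(`span_origin_of_mem`). OURS; NOT a statement of H. Hironaka's manuscript [Hironaka2017], nothing of which is used; no FACT-LIST premise.
AI-written; AI review is weaker than expert review. References: H. Matsumura (1986) Thm. 8.11, 28.3; The Stacks Project, Tag 0804.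
[Matsumura1987] [StacksProject] [folklore]
-/

noncomputable section

set_option linter.dupNamespace false -- mandated namespace of this single-conjunct summit

open IsLocalRing MvPolynomial

namespace Summit.ResolutionOfSingularities.ResolutionOfSingularities.Theorems

namespace CampaignW46

namespace MohWindowShadeFormalNR

open CampaignW46.FormalChart
open Literature.AlgebraicGeometry.Resolution (isNoetherianRing_adicCompletion_maximalIdeal)
open CampaignW46.AtomGerm (constantCoeff_rename_some rename_some_mem_maximalIdeal_pow mem_maximalIdeal_pow_iff_algebraMap)
open Literature.RingTheory.MvPowerSeries.Jets (mem_maximalIdeal_iff_constantCoeff_eq_zero mem_maximalIdeal_pow_of_le_order)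

section Prep

variable {p : ℕ} [hp : Fact p.Prime] {K₀ : Type} [Field K₀]
  {R : Type} [CommRing R] [IsLocalRing R] [IsNoetherianRing R]
  (E₀ : AdicCompletion (maximalIdeal R) R ≃+* MvPowerSeries (Option (Fin 2)) K₀)

/-- **The residue field of `R` read through Cohen coordinates**: `R → R̂ ≅ K₀⟦X⟧ → K₀` (constant coefficient) is onto with kernel `𝔪_R`,
whence `κ(R) ≅ K₀` compatibly. [cite: Matsumura1987, Thm. 28.3] [folklore] -/
theorem exists_residueField_ringEquiv :
    ∃ θ : ResidueField R ≃+* K₀, ∀ r : R, θ (residue R r) =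
      MvPowerSeries.constantCoeff (E₀ (algebraMap R (AdicCompletion (maximalIdeal R) R) r)) := by
  set ofR := algebraMap R (AdicCompletion (maximalIdeal R) R) with hofR
  set ev₀ : R →+* K₀ := (MvPowerSeries.constantCoeff.comp (E₀ : _ →+* MvPowerSeries (Option (Fin 2)) K₀)).comp ofR with hev₀
  have hev₀app : ∀ r, ev₀ r = MvPowerSeries.constantCoeff (E₀ (ofR r)) := fun r => rfl
  have hker : RingHom.ker ev₀ = maximalIdeal R := by
    ext r
    rw [RingHom.mem_ker, hev₀app, ← mem_maximalIdeal_iff_constantCoeff_eq_zero]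
    constructor
    · intro h
      have h1 : ofR r ∈ maximalIdeal (AdicCompletion (maximalIdeal R) R) := by
        have := ringEquiv_mem_maximalIdeal E₀.symm h
        rwa [RingEquiv.symm_apply_apply] at this
      have h2 := (mem_maximalIdeal_pow_iff_algebraMap 1 r).mpr (by rw [pow_one]; exact h1)
      rwa [pow_one] at h2
    · intro h
      have h2 := (mem_maximalIdeal_pow_iff_algebraMap 1 r).mp (by rw [pow_one]; exact h)
      rw [pow_one] at h2
      exact ringEquiv_mem_maximalIdeal E₀ h2
  have hsurj : Function.Surjective ev₀ := by
    intro l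
    obtain ⟨xbar, hx⟩ := (AdicCompletion.residueField_map_bijective R).2 (residue _ (E₀.symm (MvPowerSeries.C l)))
    obtain ⟨r, rfl⟩ := residue_surjective xbar
    refine ⟨r, ?_⟩
    rw [ResidueField.map_residue] at hx
    have h1 : ofR r - E₀.symm (MvPowerSeries.C l) ∈ maximalIdeal _ := by rw [← Ideal.Quotient.eq]; exact hx
    have h2 : E₀ (ofR r) - MvPowerSeries.C l ∈ maximalIdeal (MvPowerSeries (Option (Fin 2)) K₀) := by
      have := ringEquiv_mem_maximalIdeal E₀ h1
      rwa [map_sub, RingEquiv.apply_symm_apply] at this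
    rw [mem_maximalIdeal_iff_constantCoeff_eq_zero, map_sub, MvPowerSeries.constantCoeff_C, sub_eq_zero] at h2
    rw [hev₀app, h2]
  refine ⟨(Ideal.quotEquivOfEq hker.symm).trans (RingHom.quotientKerEquivOfSurjective hsurj), fun r => ?_⟩
  change (RingHom.quotientKerEquivOfSurjective hsurj) ((Ideal.quotEquivOfEq hker.symm) (Ideal.Quotient.mk (maximalIdeal R) r)) = _
  rw [Ideal.quotEquivOfEq_mk, RingHom.quotientKerEquivOfSurjective_apply_mk, hev₀app]

/-- Irreducibility of the reduction of `π̃ ∈ R[X]` passes from the residue field to the coefficient field read through `E₀`. [folklore] -/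
theorem irreducible_map_ev₀ {πR : Polynomial R} (h : Irreducible (πR.map (residue R))) :
    Irreducible (πR.map ((MvPowerSeries.constantCoeff.comp (E₀ : _ →+* MvPowerSeries (Option (Fin 2)) K₀)).comp
      (algebraMap R (AdicCompletion (maximalIdeal R) R)))) := by
  obtain ⟨θ, hθ⟩ := exists_residueField_ringEquiv E₀
  have hcomp : (θ : ResidueField R →+* K₀).comp (residue R) =
      (MvPowerSeries.constantCoeff.comp (E₀ : _ →+* MvPowerSeries (Option (Fin 2)) K₀)).comp (algebraMap R (AdicCompletion (maximalIdeal R) R)) :=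
    RingHom.ext fun r => hθ r
  rw [← hcomp, ← Polynomial.map_map]
  exact (MulEquiv.irreducible_iff (Polynomial.mapEquiv θ)).mpr h

variable [CharP K₀ p] (c : Option (Fin 2) → R) (hc : Ideal.span (Set.range c) = maximalIdeal R)
  (hcX : ∀ j, E₀ (algebraMap R (AdicCompletion (maximalIdeal R) R) (c j)) - MvPowerSeries.X j ∈
    maximalIdeal (MvPowerSeries (Option (Fin 2)) K₀) ^ 2)

include hcX in
/-- **`f₀ ≡ u · c_z^p (mod 𝔪_R^{p+1})` for a unit `u`** when `E₀(f₀) = w · (z^p + F(u))` with `ord F > p`: the series `F(u)` and the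
correction `(E₀ c_z − X_z)^p` lie in `𝔪̂^{p+1}`, and the unit `E₀⁻¹ w` is approximated from `R`. [cite: Matsumura1987, Thm. 8.11] [folklore] -/
theorem exists_unit_sub_mul_pow_mem (f₀ : R) (w₀ : MvPowerSeries (Option (Fin 2)) K₀) (hw₀ : IsUnit w₀) (F : MvPowerSeries (Fin 2) K₀)
    (hF : ((p + 1 : ℕ) : ℕ∞) ≤ F.order)
    (hf₀ : E₀ (algebraMap R (AdicCompletion (maximalIdeal R) R) f₀) =
      w₀ * (MvPowerSeries.X none ^ p + MvPowerSeries.rename (some : Fin 2 → Option (Fin 2)) F)) :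
    ∃ u : R, IsUnit u ∧ f₀ - u * c none ^ p ∈ maximalIdeal R ^ (p + 1) := by
  set ofR := algebraMap R (AdicCompletion (maximalIdeal R) R) with hofR
  haveI : CharP (MvPowerSeries (Option (Fin 2)) K₀) p :=
    charP_of_injective_algebraMap (algebraMap K₀ (MvPowerSeries (Option (Fin 2)) K₀)).injective p
  haveI : IsNoetherianRing (AdicCompletion (maximalIdeal R) R) := isNoetherianRing_adicCompletion_maximalIdeal R
  -- `E₀(c_z^p) ≡ X_z^p` and `F(u) ≡ 0` modulo `𝔪̂^{p+1}`
  set δ := E₀ (ofR (c none)) - MvPowerSeries.X none with hδ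
  have hδp : δ ^ p ∈ maximalIdeal (MvPowerSeries (Option (Fin 2)) K₀) ^ (p + 1) := by
    have h1 : δ ^ p ∈ maximalIdeal (MvPowerSeries (Option (Fin 2)) K₀) ^ (2 * p) := by rw [pow_mul]; exact Ideal.pow_mem_pow (hcX none) p
    exact Ideal.pow_le_pow_right (by have := hp.out.two_le; omega) h1
  have hcp : E₀ (ofR (c none ^ p)) = MvPowerSeries.X none ^ p + δ ^ p := by
    rw [map_pow, map_pow, show E₀ (ofR (c none)) = MvPowerSeries.X none + δ by rw [hδ]; ring, add_pow_char]
  have hFm : MvPowerSeries.rename (some : Fin 2 → Option (Fin 2)) F ∈ maximalIdeal (MvPowerSeries (Option (Fin 2)) K₀) ^ (p + 1) :=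
    rename_some_mem_maximalIdeal_pow (mem_maximalIdeal_pow_of_le_order hF)
  -- approximate the unit `E₀⁻¹ w₀` from `R`
  obtain ⟨ubar, hubar⟩ := (AdicCompletion.residueField_map_bijective R).2 (residue _ (E₀.symm w₀))
  obtain ⟨u, rfl⟩ := residue_surjective ubar
  rw [ResidueField.map_residue] at hubar
  have hu𝔪 : ofR u - E₀.symm w₀ ∈ maximalIdeal _ := by rw [← Ideal.Quotient.eq]; exact hubar
  have hunit : IsUnit (E₀.symm w₀) := hw₀.map E₀.symm
  have hu : IsUnit u := by
    by_contra hnu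
    have h1 : ofR u ∈ maximalIdeal (AdicCompletion (maximalIdeal R) R) := by
      have := (mem_maximalIdeal_pow_iff_algebraMap 1 u).mp (by rw [pow_one]; exact (mem_maximalIdeal _).mpr hnu)
      rwa [pow_one] at this
    have h2 : E₀.symm w₀ ∈ maximalIdeal _ := by
      have := Ideal.sub_mem _ h1 hu𝔪; rwa [sub_sub_cancel] at this
    exact (mem_maximalIdeal _).mp h2 hunit
  refine ⟨u, hu, ?_⟩
  -- `E₀(f₀ − u c_z^p) = (w₀ − E₀ u) X_z^p + w₀ F(u) − E₀(u) δ^p ∈ 𝔪^{p+1}`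
  have hwu : w₀ - E₀ (ofR u) ∈ maximalIdeal (MvPowerSeries (Option (Fin 2)) K₀) := by
    have := ringEquiv_mem_maximalIdeal E₀ hu𝔪
    rw [map_sub, RingEquiv.apply_symm_apply] at this
    rw [← Ideal.neg_mem_iff, neg_sub]; exact this
  have hXp : (MvPowerSeries.X none : MvPowerSeries (Option (Fin 2)) K₀) ^ p ∈ maximalIdeal (MvPowerSeries (Option (Fin 2)) K₀) ^ p :=
    Ideal.pow_mem_pow (mem_maximalIdeal_iff_constantCoeff_eq_zero.mpr (MvPowerSeries.constantCoeff_X _)) p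
  have hmem : E₀ (ofR (f₀ - u * c none ^ p)) ∈ maximalIdeal (MvPowerSeries (Option (Fin 2)) K₀) ^ (p + 1) := by
    have e1 : E₀ (ofR (f₀ - u * c none ^ p)) = (w₀ - E₀ (ofR u)) * MvPowerSeries.X none ^ p +
        w₀ * MvPowerSeries.rename (some : Fin 2 → Option (Fin 2)) F - E₀ (ofR u) * δ ^ p := by
      rw [map_sub, map_mul, map_sub, map_mul, hf₀, hcp]; ring
    rw [e1]
    refine Ideal.sub_mem _ (Ideal.add_mem _ ?_ (Ideal.mul_mem_left _ _ hFm)) (Ideal.mul_mem_left _ _ hδp)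
    rw [pow_succ', ]
    exact Ideal.mul_mem_mul hwu hXp
  exact (mem_maximalIdeal_pow_iff_algebraMap (p + 1) _).mpr (by
    have := ringEquiv_mem_maximalIdeal_pow E₀.symm hmem
    rwa [RingEquiv.symm_apply_apply] at this)

variable {L : Type} [CommRing L] [IsLocalRing L] (g : R →+* L) (hg : (maximalIdeal R).map g ≤ maximalIdeal L)

include hc in
omit [IsNoetherianRing R] [IsLocalRing L] hp [CharP K₀ p] in
/-- `g(𝔪_R^k) ⊆ (g cᵢ)^k` in the chart `cᵢ`. [folklore] -/
theorem map_maximalIdeal_pow_le {i : Option (Fin 2)} (e : Option (Fin 2) → L) (he : ∀ j, g (c j) = g (c i) * e j) (k : ℕ) :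
    (maximalIdeal R ^ k).map g ≤ Ideal.span {g (c i) ^ k} := by
  have h1 : (maximalIdeal R).map g ≤ Ideal.span {g (c i)} := by
    rw [← hc, Ideal.map_span, Ideal.span_le]
    rintro _ ⟨_, ⟨j, rfl⟩, rfl⟩
    rw [SetLike.mem_coe, he j]
    exact Ideal.mul_mem_right _ _ (Ideal.mem_span_singleton_self _)
  rw [Ideal.map_pow, ← Ideal.span_singleton_pow]
  exact Ideal.pow_right_mono h1 k

include hc hg in
omit [IsNoetherianRing R] hp in
/-- **At a point of the chart `cᵢ`, `i ≠ z`, where the controlled transform is not a unit, the fibre quotient `e_z = c_z/cᵢ` lies in `𝔪`**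
(`f₀ ≡ u c_z^p`: `f′ = g(u) e_z^p + g(cᵢ)·ℓ`). [cite: StacksProject, Tag 0804] [folklore] -/
theorem e_mem_maximalIdeal_of_transform {i : Option (Fin 2)} (e : Option (Fin 2) → L) (he : ∀ j, g (c j) = g (c i) * e j)
    (hnzd : g (c i) ∈ nonZeroDivisors L) {f₀ u : R} (hu : IsUnit u) (hf₀u : f₀ - u * c none ^ p ∈ maximalIdeal R ^ (p + 1))
    (f' : L) (hf' : g f₀ = g (c i) ^ p * f') (hf'𝔪 : f' ∈ maximalIdeal L) : e none ∈ maximalIdeal L := by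
  obtain ⟨ℓ, hℓ⟩ := Ideal.mem_span_singleton'.mp (map_maximalIdeal_pow_le c hc g e he (p + 1) (Ideal.mem_map_of_mem g hf₀u))
  -- `g(cᵢ)^p · (f′ − g(u) e_z^p − g(cᵢ) ℓ) = 0`
  have h1 : g (c i) ^ p * (f' - g u * e none ^ p - g (c i) * ℓ) = 0 := by
    have e1 : g (c i) ^ p * (f' - g u * e none ^ p - g (c i) * ℓ) = g f₀ - g u * (g (c i) * e none) ^ p - ℓ * g (c i) ^ (p + 1) := by
      rw [hf']; ring
    rw [e1, ← he none, ← map_pow, ← map_mul, ← map_sub, hℓ, sub_self]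
  have h2 : f' - g u * e none ^ p - g (c i) * ℓ = 0 := (mul_left_mem_nonZeroDivisors_eq_zero_iff (pow_mem hnzd p)).mp h1
  have hci : g (c i) ∈ maximalIdeal L := hg (Ideal.mem_map_of_mem _ (hc ▸ Ideal.subset_span ⟨i, rfl⟩))
  have h3 : g u * e none ^ p ∈ maximalIdeal L := by
    have e1 : g u * e none ^ p = f' - g (c i) * ℓ := by linear_combination -h2
    rw [e1]; exact Ideal.sub_mem _ hf'𝔪 (Ideal.mul_mem_right _ _ hci)
  have h4 : e none ^ p ∈ maximalIdeal L := (Ideal.unit_mul_mem_iff_mem _ (hu.map g)).mp h3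
  exact Ideal.IsPrime.mem_of_pow_mem inferInstance p h4

include hc hg in
omit [IsNoetherianRing R] hp in
/-- **The origin of the `z`-chart is never a point where the controlled transform is a non-unit** (there `f′ = g(u) + g(c_z)·ℓ` is a unit).
Non-rational twin of gen 6's `not_mem_maximalIdeal_transform_of_zChart_series`. [cite: StacksProject, Tag 0804] [folklore] -/
theorem false_of_zChart_nr (e : Option (Fin 2) → L) (he : ∀ j, g (c j) = g (c none) * e j)
    (hnzd : g (c none) ∈ nonZeroDivisors L) {f₀ u : R} (hu : IsUnit u) (hf₀u : f₀ - u * c none ^ p ∈ maximalIdeal R ^ (p + 1))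
    (f' : L) (hf' : g f₀ = g (c none) ^ p * f') (hf'𝔪 : f' ∈ maximalIdeal L) : False := by
  obtain ⟨ℓ, hℓ⟩ := Ideal.mem_span_singleton'.mp (map_maximalIdeal_pow_le c hc g e he (p + 1) (Ideal.mem_map_of_mem g hf₀u))
  have h1 : g (c none) ^ p * (f' - g u - g (c none) * ℓ) = 0 := by
    have e1 : g (c none) ^ p * (f' - g u - g (c none) * ℓ) = g f₀ - g u * g (c none) ^ p - ℓ * g (c none) ^ (p + 1) := by
      rw [hf']; ring
    rw [e1, ← map_pow, ← map_mul, ← map_sub, hℓ, sub_self]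
  have h2 : f' - g u - g (c none) * ℓ = 0 := (mul_left_mem_nonZeroDivisors_eq_zero_iff (pow_mem hnzd p)).mp h1
  have hci : g (c none) ∈ maximalIdeal L := hg (Ideal.mem_map_of_mem _ (hc ▸ Ideal.subset_span ⟨none, rfl⟩))
  have h3 : g u ∈ maximalIdeal L := by
    have e1 : g u = f' - g (c none) * ℓ := by linear_combination -h2
    rw [e1]; exact Ideal.sub_mem _ hf'𝔪 (Ideal.mul_mem_right _ _ hci)
  exact (mem_maximalIdeal _).mp h3 (hu.map g)

include hc in
omit [IsNoetherianRing R] in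
/-- **The origin of a chart as non-rational chart data with `π̃ = X`.** If `𝔪_L = (g cᵢ, e_z, π̃^g(e_y))` and `e_y ∈ 𝔪_L`, then
`𝔪_L = (g cᵢ, e_z, X^g(e_y))` (the constant term of `π̃` is then in `𝔪_R`, and `g(𝔪_R) ⊆ (g cᵢ)`). [folklore] -/
theorem span_origin_of_mem {i : Option (Fin 2)} (e : Option (Fin 2) → L) (he : ∀ j, g (c j) = g (c i) * e j) {z y : Option (Fin 2)}
    (πR : Polynomial R) (hgen : Ideal.span {g (c i), e z, (πR.map g).eval (e y)} = maximalIdeal L) (hey : e y ∈ maximalIdeal L) :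
    Ideal.span {g (c i), e z, ((Polynomial.X : Polynomial R).map g).eval (e y)} = maximalIdeal L := by
  rw [Polynomial.map_X, Polynomial.eval_X]
  apply le_antisymm
  · rw [Ideal.span_le]
    rintro t ht
    simp only [Set.mem_insert_iff, Set.mem_singleton_iff] at ht
    rcases ht with rfl | rfl | rfl
    · rw [SetLike.mem_coe, ← hgen]; exact Ideal.subset_span (by simp)
    · rw [SetLike.mem_coe, ← hgen]; exact Ideal.subset_span (by simp)
    · exact hey
  · rw [← hgen, Ideal.span_le]
    rintro t ht
    simp only [Set.mem_insert_iff, Set.mem_singleton_iff] at ht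
    rw [SetLike.mem_coe]
    rcases ht with rfl | rfl | rfl
    · exact Ideal.subset_span (by simp)
    · exact Ideal.subset_span (by simp)
    · -- `π̃^g(e_y) = (divX π̃)^g(e_y) · e_y + g(π̃(0))`
      have hsplit : (πR.map g).eval (e y) = e y * ((Polynomial.divX πR).map g).eval (e y) + g (πR.coeff 0) := by
        conv_lhs => rw [← Polynomial.X_mul_divX_add πR]
        rw [Polynomial.map_add, Polynomial.map_mul, Polynomial.map_X, Polynomial.map_C, Polynomial.eval_add, Polynomial.eval_mul,
          Polynomial.eval_X, Polynomial.eval_C]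
      have h0 : g (πR.coeff 0) ∈ maximalIdeal L := by
        have h1 : (πR.map g).eval (e y) ∈ maximalIdeal L := by rw [← hgen]; exact Ideal.subset_span (by simp)
        have := Ideal.sub_mem _ h1 (Ideal.mul_mem_right (((Polynomial.divX πR).map g).eval (e y)) _ hey)
        rwa [hsplit, add_sub_cancel_left] at this
      have h0R : πR.coeff 0 ∈ maximalIdeal R := by
        by_contra hne
        exact (mem_maximalIdeal _).mp h0 (((mem_maximalIdeal _).not.mp hne |> not_not.mp).map g)
      have h0' : g (πR.coeff 0) ∈ Ideal.span {g (c i), e z, e y} := by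
        have := map_maximalIdeal_pow_le c hc g e he 1 (Ideal.mem_map_of_mem g (by rw [pow_one]; exact h0R))
        rw [pow_one] at this
        exact Ideal.span_mono (by simp) this
      rw [hsplit]
      exact Ideal.add_mem _ (Ideal.mul_mem_right _ _ (Ideal.subset_span (by simp))) h0'

end Prep

end MohWindowShadeFormalNR

end CampaignW46

end Summit.ResolutionOfSingularities.ResolutionOfSingularities.Theorems

end
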